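import Summits.QuantumFields.QCD.Theorems.NestedDissectionSeaRobustYangMillsStubDeploymentUKP
import Literature.Probability.LatticeModels.CoarseCellMixingDefectsBlockLeak
import Summits.QuantumFields.QCD.Theorems.NestedDissectionSeaRobustYangMillsStubEngineOfAnnealed

/-!
# Line `local-ac-open-certificate` for the crux `RobustYangMills` (stmt-QuantumFields-13897) —
# reshape r4: the engine over BLOCK quasi-locality (`HasBlockLeak`)

Crux: `Summit.QuantumFields.QCD.Theses.NestedDissectionSea.RobustYangMills` (shared verbatim with
`HeavyThresholdYMBridge` / `AdaptiveBlockFermions`); checked skeleton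
`Cruxes/RobustYangMills/Lines/local_ac_open_certificate.lean`; companion modules
`NestedDissectionSeaRobustYangMillsLocalAC` (§0–§1, `stub_localAC`),
`NestedDissectionSeaRobustYangMillsStubDeployment{,UKP}` (§2–§3, `stub_deployment{,UKP}`) and
`NestedDissectionSeaRobustYangMillsStubEngineOfAnnealed` (reshape r3: `PerturbedMixingEngineUKP`,
`AnnealedEngine`, `stub_engineOfAnnealed`).

**Why r4.** Wave 3 of the previous lead found `AnnealedEngine` (r3) not derivable from its hypotheses:
its leak profile `HasLeak` only controls CENTRAL-cell marginals of cube kernels, while any expansion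
around Peierls-rare bad cells resamples whole bad clusters and needs the quasi-locality of the
resulting BLOCK kernels for arbitrary block-local observables. The honest datum is the ratio-form block
quasi-locality `HasBlockLeak cell γ a r` of `Literature/…/CoarseCellMixingDefectsBlockLeak.lean`, which
the Yang–Mills kernels satisfy for free under (h3) ∧ (h4)
(`QuasiLocalGaugePerturbation.hasBlockLeak_kernel_of_card_le`, amplitude `a = 4ηK`, rate `κ`; Wilson's
kernels with amplitude `0`). This module carries the r4 vocabulary:

* `AnnealedEngineBQL` — the classical one-specification mixing theorem with Peierls-rare defects over
  `HasBlockLeak cell γ a r`, `a ≤ a₀(n, r)` (statement of the OPEN stub `stub_annealedEngineBQL`);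
  `AnnealedEngineBQLMarkov` — its block-Markov instance `a = 0` (van den Berg–Maes; proved in the
  companion Literature series `CoarseCellMixingDefects…`, landing as a `--supports` lemma);
* `PerturbedMixingEngineBQL` — the engine (reference `γ₀` with the good-exterior finite-size condition
  and the kernel-uniform Peierls bound, perturbed `γ` locally a.c. w.r.t. `γ₀` and block-quasi-local),
  statement of the CLOSED stub `stub_engineOfAnnealedBQL : AnnealedEngineBQL → PerturbedMixingEngineBQL`,
  PROVED here (the r3 argument of `stub_engineOfAnnealed` with `HasBlockLeak` binders);
* `DeploymentBQL` — toolkit + BQL-engine + UKP-certificate ⇒ uniform IR clustering of the cone for every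
  `κ ≥ 1` (the composition only uses `κ = max 1 κ₄ ≥ 1`; the engine is run at leak rate `1`, so the
  rarity threshold `p₀` handed to the certificate does not depend on `κ`), statement of the CLOSED
  stub `stub_deploymentBQL`;
* `HasBlockLeak.of_le` — monotonicity of block quasi-locality in amplitude and rate.

Quantifier shapes. `AnnealedEngineBQL : ∀ n ≥ 1, ∀ r > 0, ∃ q₀ a₀ κₑ C, …`; the factor `exp(|Δf|)` in
place of `|Δf|` records the one-shot expansion around all bad clusters attached to the observable's
cells (a seed of `m` cells carries `(1 + O(q))^m` cluster shapes); for species observables `|Δf|` is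
bounded, so the deployment absorbs it into the pair constant.

Sources: van den Berg–Maes, Ann. Probab. 22 (1994) §2; Dobrushin–Shlosman (1985) §2 and J. Stat.
Phys. 46 (1987); Georgii (2011) §8.2 and Rem. 1.24.
-/

set_option autoImplicit false

noncomputable section

namespace Summit.QuantumFields.QCD.Cruxes.RobustYangMills.LocalAcOpenCertificate

open scoped BigOperators ENNReal
open MeasureTheory
open Literature.Probability.LatticeModels (CoarseIdx cdist shellCount cellCount IsGoodFS HasLeak
  HasBlockLeak IsLocallyAC PeierlsRare UniformKernelPeierls Specification IsSpecification IsGibbsMeasure)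

/-! ## Block quasi-locality is monotone -/

/-- `HasBlockLeak` is monotone in the amplitude and antitone in the rate: a bound with `(a, r)`
gives one with any `a' ≥ a` and `r' ≤ r` (for `a' ≥ 0`; the rate enters only through
`e^{-rD} ≤ e^{-r'D}`). -/
theorem HasBlockLeak.of_le {d : ℕ} {μc : Fin d → ℕ} {V S : Type} [MeasurableSpace S] [Fintype V]
    {cell : V → CoarseIdx μc} {γ : Specification V S} {a a' r r' : ℝ}
    (h : HasBlockLeak cell γ a r) (ha : a ≤ a') (ha' : 0 ≤ a') (hr : r' ≤ r) :
    HasBlockLeak cell γ a' r' := by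
  intro A hA D ζ ζ' hagree f hf hf01 hdep
  refine (h A hA D ζ ζ' hagree f hf hf01 hdep).trans
    (mul_le_mul_of_nonneg_right (Real.exp_le_exp.2 ?_) (integral_nonneg fun σ => (hf01 σ).1))
  have h1 : Real.exp (-(r * D)) ≤ Real.exp (-(r' * D)) :=
    Real.exp_le_exp.2 (neg_le_neg (mul_le_mul_of_nonneg_right hr (Nat.cast_nonneg D)))
  calc a * cellCount cell A * Real.exp (-(r * D))
      ≤ a' * cellCount cell A * Real.exp (-(r * D)) :=
        mul_le_mul_of_nonneg_right (mul_le_mul_of_nonneg_right ha (Nat.cast_nonneg _))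
          (Real.exp_pos _).le
    _ ≤ a' * cellCount cell A * Real.exp (-(r' * D)) :=
        mul_le_mul_of_nonneg_left h1 (mul_nonneg ha' (Nat.cast_nonneg _))

/-! ## §2″ Reshape r4: the annealed engine and the engine over block quasi-locality -/

/-- **The annealed engine over block quasi-locality** (classical, `G`-blind; statement of the OPEN
stub `stub_annealedEngineBQL`): for every window `n ≥ 1` and leak rate `r > 0` there are thresholds
`q₀, a₀ > 0`, a rate `κₑ > 0` and a constant `C` such that ONE specification on a coarse 4-torus
(`≥ 4n+3` cells per axis) with the good-exterior finite-size condition at `(n, ε)`,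
`ε·shellCount 4 n ≤ 3/4`, block quasi-locality `HasBlockLeak cell γ a r` with `a ≤ a₀` and the
kernel-uniform Peierls bound at level `q ≤ q₀` has, for every Gibbs measure `ν`, averaged boundary
influence `∫ |γ_Λ f - ν f| dν ≤ C e^{|Δf|} |Δg| e^{-κₑ D}` for `[0,1]`-valued observables `f` of the
cells `Δf`, `Λ` the sites whose cell is not in `Δg`, `D ≤ cdist(Δf, Δg)` (van den Berg–Maes
disagreement percolation / Dobrushin–Shlosman with Peierls-rare defects, quasi-local form; not a
textbook theorem in this form). -/
def AnnealedEngineBQL : Prop :=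
  ∀ n : ℕ, 1 ≤ n → ∀ r : ℝ, 0 < r → ∃ q₀ a₀ κₑ C : ℝ, 0 < q₀ ∧ 0 < a₀ ∧ 0 < κₑ ∧ 0 ≤ C ∧
    ∀ (μc : Fin 4 → ℕ) (V S : Type) [Fintype V] [MeasurableSpace S] (cell : V → CoarseIdx μc)
      (γ : Specification V S) (good : CoarseIdx μc → Set (V → S)) (ν : Measure (V → S))
      (ε q a : ℝ),
      (∀ i, 4 * n + 3 ≤ μc i + 1) → IsSpecification γ → IsGibbsMeasure γ ν →
      0 ≤ ε → ε * (shellCount 4 n : ℝ) ≤ 3 / 4 → IsGoodFS cell γ good n ε →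
      0 ≤ a → a ≤ a₀ → HasBlockLeak cell γ a r →
      0 ≤ q → q ≤ q₀ → UniformKernelPeierls cell γ good q →
      ∀ (f : (V → S) → ℝ) (Δf Δg : Finset (CoarseIdx μc)) (D : ℕ),
        Measurable f → (∀ σ, 0 ≤ f σ ∧ f σ ≤ 1) → DependsOn f {v | cell v ∈ Δf} →
        (∀ x ∈ Δf, ∀ y ∈ Δg, D ≤ cdist x y) →
          ∫ ζ, |∫ σ, f σ ∂(γ (Finset.univ.filter fun v => cell v ∉ Δg) ζ) - ∫ σ, f σ ∂ν| ∂ν ≤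
            C * Real.exp (Δf.card) * Δg.card * Real.exp (-(κₑ * D))

/-- **The block-Markov instance of the annealed engine** (`a = 0`: Markov specifications at the cell
scale with Peierls-rare defects; van den Berg–Maes (1994) run through cells, in the TV/finite-size form).
This is `AnnealedEngineBQL` specialised to amplitude `0`; it is what the companion Literature series
proves outright. -/
def AnnealedEngineBQLMarkov : Prop :=
  ∀ n : ℕ, 1 ≤ n → ∃ q₀ κₑ C : ℝ, 0 < q₀ ∧ 0 < κₑ ∧ 0 ≤ C ∧
    ∀ (μc : Fin 4 → ℕ) (V S : Type) [Fintype V] [MeasurableSpace S] (cell : V → CoarseIdx μc)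
      (γ : Specification V S) (good : CoarseIdx μc → Set (V → S)) (ν : Measure (V → S))
      (ε q r : ℝ),
      (∀ i, 4 * n + 3 ≤ μc i + 1) → IsSpecification γ → IsGibbsMeasure γ ν →
      0 ≤ ε → ε * (shellCount 4 n : ℝ) ≤ 3 / 4 → IsGoodFS cell γ good n ε →
      HasBlockLeak cell γ 0 r →
      0 ≤ q → q ≤ q₀ → UniformKernelPeierls cell γ good q →
      ∀ (f : (V → S) → ℝ) (Δf Δg : Finset (CoarseIdx μc)) (D : ℕ),
        Measurable f → (∀ σ, 0 ≤ f σ ∧ f σ ≤ 1) → DependsOn f {v | cell v ∈ Δf} →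
        (∀ x ∈ Δf, ∀ y ∈ Δg, D ≤ cdist x y) →
          ∫ ζ, |∫ σ, f σ ∂(γ (Finset.univ.filter fun v => cell v ∉ Δg) ζ) - ∫ σ, f σ ∂ν| ∂ν ≤
            C * Real.exp (Δf.card) * Δg.card * Real.exp (-(κₑ * D))

/-- The quasi-local annealed engine contains its block-Markov instance (take any `r > 0`, `a = 0`). -/
theorem annealedEngineBQLMarkov_of_BQL (h : AnnealedEngineBQL) : AnnealedEngineBQLMarkov := by
  intro n hn
  obtain ⟨q₀, a₀, κₑ, C, hq₀, ha₀, hκₑ, hC, hmain⟩ := h n hn 1 one_pos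
  refine ⟨q₀, κₑ, C, hq₀, hκₑ, hC, ?_⟩
  intro μc V S _ _ cell γ good ν ε q r hμc hγ hν hε hεs hFS hBL hq hqq₀ hUKP f Δf Δg D hf hf01 hfdep hD
  have hBL' : HasBlockLeak cell γ 0 1 := by
    intro A hA D' ζ ζ' hagree g hg hg01 hdep
    have h0 := hBL A hA D' ζ ζ' hagree g hg hg01 hdep
    simpa using h0
  exact hmain μc V S cell γ good ν ε q 0 hμc hγ hν hε hεs hFS le_rfl ha₀.le hBL' hq hqq₀ hUKP f Δf Δg
    D hf hf01 hfdep hD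

/-- **The engine over block quasi-locality** (reshape r4; statement of
`stub_engineOfAnnealedBQL : AnnealedEngineBQL → PerturbedMixingEngineBQL`): for every window `n ≥ 1`
and leak rate `r > 0` thresholds `p₀(n,r), ε₁(n,r), a₀(n,r) > 0`, and for every `ε₀` a rate `κₑ > 0`
and `C₀ ≥ 0`, such that a specification `γ` locally a.c. at rate `ε₁` w.r.t. a reference `γ₀` with
the good-exterior finite-size condition `(n, ε₀)`, block-quasi-local with `HasBlockLeak cell γ a r`,
`a ≤ a₀`, bad cells Peierls-rare under the reference KERNELS (`UniformKernelPeierls cell γ₀ good p`,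
`p ≤ p₀`), on a coarse 4-torus with `≥ 4n+3` cells per axis, has covariance decay
`C₀ B_f B_g e^{|Δf|} |Δg| e^{-κₑ D}` for every Gibbs measure. -/
def PerturbedMixingEngineBQL : Prop :=
  ∀ n : ℕ, 1 ≤ n → ∀ r : ℝ, 0 < r → ∃ p₀ ε₁ a₀ : ℝ, 0 < p₀ ∧ 0 < ε₁ ∧ 0 < a₀ ∧
    ∀ ε₀ : ℝ, 0 ≤ ε₀ → 2 * ε₀ * (shellCount 4 n : ℝ) ≤ 1 →
    ∃ κₑ C₀ : ℝ, 0 < κₑ ∧ 0 ≤ C₀ ∧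
    ∀ (μc : Fin 4 → ℕ) (V S : Type) [Fintype V] [MeasurableSpace S] (cell : V → CoarseIdx μc)
      (γ₀ γ : Specification V S) (good : CoarseIdx μc → Set (V → S)) (ν : Measure (V → S))
      (p a : ℝ),
      (∀ i, 4 * n + 3 ≤ μc i + 1) → IsSpecification γ₀ → IsSpecification γ → IsGibbsMeasure γ ν →
      IsGoodFS cell γ₀ good n ε₀ → 0 ≤ a → a ≤ a₀ → HasBlockLeak cell γ a r →
      IsLocallyAC cell γ γ₀ ε₁ → 0 ≤ p → p ≤ p₀ → UniformKernelPeierls cell γ₀ good p →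
      ∀ (f g : (V → S) → ℝ) (Δf Δg : Finset (CoarseIdx μc)) (Bf Bg : ℝ) (D : ℕ),
        Measurable f → Measurable g → (∀ σ, |f σ| ≤ Bf) → (∀ σ, |g σ| ≤ Bg) →
        DependsOn f {v | cell v ∈ Δf} → DependsOn g {v | cell v ∈ Δg} →
        (∀ x ∈ Δf, ∀ y ∈ Δg, D ≤ cdist x y) →
          |∫ σ, f σ * g σ ∂ν - (∫ σ, f σ ∂ν) * ∫ σ, g σ ∂ν| ≤
            C₀ * Bf * Bg * Real.exp (Δf.card) * Δg.card * Real.exp (-(κₑ * D))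

/-- **Deployment over block quasi-locality** (reshape r4; statement of `stub_deploymentBQL`):
toolkit + BQL-engine + UKP-certificate give uniform IR clustering of the translation-invariant
sup-small range-controlled cone for EVERY decay rate `κ ≥ 1`, with a budget `η₁(κ) > 0` and the
certificate's scale `c₁` (the engine is run at leak rate `1 ≤ κ`, so `c₁ = c₁(p₀(n, 1))` does not
depend on `κ`; the composition uses `κ = max 1 κ₄`). -/
def DeploymentBQL : Prop :=
  LocalACToolkit → PerturbedMixingEngineBQL → WilsonGoodCertificateUKP →
    ∃ c₁ : ℝ, 0 < c₁ ∧ ∀ κ : ℝ, 1 ≤ κ → ∃ η₁ : ℝ, 0 < η₁ ∧ IRConeClustering η₁ κ c₁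


/-! ## Proof of `stub_engineOfAnnealedBQL` (CLOSED; the r3 argument with `HasBlockLeak`) -/

section Proof

open Literature.Probability.LatticeModels (isGoodFS_of_isLocallyAC kernel_allBad_le_of_uniformKernelPeierls
  abs_covariance_le_integral_abs integral_abs_kernel_sub_rescale)

/-- **`stub_engineOfAnnealedBQL` (CLOSED)**: the annealed BQL engine implies the BQL engine. Thresholds
`ε₁ = epsOne n` (the perturbed finite-size threshold `ε = ε₀ + 1/(4·shellCount 4 n)` of
`isGoodFS_of_isLocallyAC` has `ε·shellCount ≤ 3/4`), `p₀ = q₀ e^{-81 ε₁}` (the perturbed kernels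
satisfy the uniform Peierls bound at level `e^{81ε₁} p ≤ q₀`, `kernel_allBad_le_of_uniformKernelPeierls`),
`a₀` of the annealed engine at `(n, r)`; constants `(κₑ, 2C)`; then
`|cov_ν(f,g)| ≤ B_g ∫ |γ_Λ f - ν f| dν` for `Λ :=` the sites whose cell is not in `Δg`
(`abs_covariance_le_integral_abs`), the rescaling of `f` to `[0,1]` (`integral_abs_kernel_sub_rescale`,
factor `2B_f`; `B_f = 0` forces `f = 0`) and the annealed bound. -/
theorem stub_engineOfAnnealedBQL : AnnealedEngineBQL → PerturbedMixingEngineBQL := by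
  intro hA n hn r hr
  obtain ⟨q₀, a₀, κₑ, C, hq₀, ha₀, hκₑ, hC, hinst⟩ := hA n hn r hr
  set ε₁ : ℝ := epsOne n with hε₁def
  have hε₁ : 0 < ε₁ := epsOne_pos n
  refine ⟨q₀ * Real.exp (-(ε₁ * 3 ^ 4)), ε₁, a₀, by positivity, hε₁, ha₀, fun ε₀ hε₀ hε₀s => ?_⟩
  refine ⟨κₑ, 2 * C, hκₑ, by positivity, ?_⟩
  intro μc V S _ _ cell γ₀ γ good ν p a hμc hγ₀ hγ hν hFS ha haa₀ hBL hAC hp hpp₀ hUKP f g Δf Δg Bf Bg D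
    hf hg hfB hgB hfdep hgdep hD
  haveI := hν.isProbabilityMeasure
  -- finite-size condition and uniform kernel Peierls bound for the perturbed specification
  have hFSγ := isGoodFS_of_isLocallyAC hγ hγ₀ hε₁.le hFS hAC
  set ε : ℝ := ε₀ + 2 * (Real.exp (ε₁ * (((4 * n + 1) ^ 4 : ℕ) : ℝ)) - 1) with hεdef
  have hs := one_le_shellCount_four n
  have hε2 : ε = ε₀ + 1 / (4 * (shellCount 4 n : ℝ)) := by
    rw [hεdef, hε₁def, two_mul_exp_epsOne_sub_one]
  have hε : 0 ≤ ε := by rw [hε2]; positivity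
  have hεs : ε * shellCount 4 n ≤ 3 / 4 := by
    have hq : 1 / (4 * (shellCount 4 n : ℝ)) * shellCount 4 n = 1 / 4 := by
      field_simp
    rw [hε2, add_mul, hq]
    linarith
  set q : ℝ := Real.exp (ε₁ * 3 ^ 4) * p with hqdef
  have hq0 : 0 ≤ q := by positivity
  have hqq₀ : q ≤ q₀ := by
    have h := mul_le_mul_of_nonneg_left hpp₀ (Real.exp_pos (ε₁ * 3 ^ 4)).le
    rw [hqdef]
    calc Real.exp (ε₁ * 3 ^ 4) * p ≤ Real.exp (ε₁ * 3 ^ 4) * (q₀ * Real.exp (-(ε₁ * 3 ^ 4))) := h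
      _ = q₀ := by rw [Real.exp_neg]; field_simp
  have hUKPγ : UniformKernelPeierls cell γ good q := fun A hA' ζ D' hD' =>
    kernel_allBad_le_of_uniformKernelPeierls hγ hFS.good_local hFS.good_meas hp hε₁.le hUKP hAC A
      hA' ζ D' hD'
  have hcoref := hinst μc V S cell γ good ν ε q a hμc hγ hν hε hεs hFSγ ha haa₀ hBL hq0 hqq₀ hUKPγ
  -- covariance ≤ averaged boundary influence, rescaled
  set Λ : Finset V := Finset.univ.filter fun v => cell v ∉ Δg with hΛ
  have hgdep' : DependsOn g ((↑Λ : Set V)ᶜ) := by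
    refine fun σ τ hστ => hgdep fun v hv => hστ v ?_
    intro hvΛ
    exact (Finset.mem_filter.1 (Finset.mem_coe.1 hvΛ)).2 hv
  obtain ⟨σ₀⟩ : Nonempty (V → S) := by
    obtain ⟨σ, -⟩ := nonempty_of_measure_ne_zero (μ := ν) (s := Set.univ) (by simp)
    exact ⟨σ⟩
  have hBf : 0 ≤ Bf := (abs_nonneg _).trans (hfB σ₀)
  have hBg : 0 ≤ Bg := (abs_nonneg _).trans (hgB σ₀)
  have hcov := abs_covariance_le_integral_abs hγ hν Λ hf hg hfB hgB hgdep'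
  have hRHS : 0 ≤ 2 * C * Bf * Bg * Real.exp (Δf.card) * Δg.card * Real.exp (-(κₑ * D)) := by
    positivity
  rcases hBf.eq_or_lt with hBf0 | hBfpos
  · have hf0 : ∀ σ, f σ = 0 := fun σ => abs_nonpos_iff.1 (hBf0 ▸ hfB σ)
    have : ∫ σ, f σ * g σ ∂ν - (∫ σ, f σ ∂ν) * ∫ σ, g σ ∂ν = 0 := by simp [hf0]
    rw [this, abs_zero]
    exact hRHS
  · set f' : (V → S) → ℝ := fun σ => (f σ / Bf + 1) / 2 with hf'
    have hf'm : Measurable f' := ((hf.div_const Bf).add_const 1).div_const 2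
    have hf'01 : ∀ σ, 0 ≤ f' σ ∧ f' σ ≤ 1 := fun σ => by
      have h := hfB σ
      rw [abs_le] at h
      have hlo : -1 ≤ f σ / Bf := by rw [le_div_iff₀ hBfpos]; linarith [h.1]
      have hhi : f σ / Bf ≤ 1 := by rw [div_le_iff₀ hBfpos]; linarith [h.2]
      simp only [hf']
      constructor <;> linarith
    have hf'dep : DependsOn f' {v | cell v ∈ Δf} := fun σ τ hστ => by
      simp only [hf', hfdep hστ]
    have hcore' := hcoref f' Δf Δg D hf'm hf'01 hf'dep hD
    have hresc := integral_abs_kernel_sub_rescale hγ (ν := ν) Λ hf hfB hBfpos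
    calc |∫ σ, f σ * g σ ∂ν - (∫ σ, f σ ∂ν) * ∫ σ, g σ ∂ν|
        ≤ Bg * ∫ ζ, |∫ σ, f σ ∂(γ Λ ζ) - ∫ σ, f σ ∂ν| ∂ν := hcov
      _ = Bg * (2 * Bf * ∫ ζ, |∫ σ, f' σ ∂(γ Λ ζ) - ∫ σ, f' σ ∂ν| ∂ν) := by rw [hresc]
      _ ≤ Bg * (2 * Bf * (C * Real.exp (Δf.card) * Δg.card * Real.exp (-(κₑ * D)))) := by gcongr
      _ = 2 * C * Bf * Bg * Real.exp (Δf.card) * Δg.card * Real.exp (-(κₑ * D)) := by ring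

end Proof

end Summit.QuantumFields.QCD.Cruxes.RobustYangMills.LocalAcOpenCertificate

end
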